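import Literature.MathematicalPhysics.KineticTheory.CollisionFluxUpperBound
import HarnessLib

/-!
# The collision-flux upper bound for the MEAN of hard-sphere collision sums

Topic `Literature/MathematicalPhysics/KineticTheory`; companion of `CollisionFluxUpperBound`, whose
Markov-form bound `measure_collisionSum_ge_le_liminf` / `localGibbsLaw_collisionMarkSum_ge_le`
(Cercignani–Illner–Pulvirenti 1994 App. 4.A: pathwise grid bound once the mesh is below the gap of
the collision times, Fatou, stationarity) is recorded here one step EARLIER, as the bound on the
MEAN it passes through:

* `lintegral_le_liminf_of_le_collisionSum` — for a hard-sphere flow `Φ` and a law `P`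
  preserved by every `Φ_t` and carried by the good set, the mean of any functional `f ≥ 0`
  dominated on the good set by the collision sum of a nonnegative mark `F(w, i, j)` over the window
  `[0, τ]` is at most `liminf_M M ∫ W_M dP`, `W_M` the one-window functional of any measurable
  window events `E_M(i,j) ⊇ {(i,j) reaches contact under a backward free flight of duration ≤ τ/M}`
  and measurable majorants `F̃_M ≥ F` (abstract geometry and law; DOMINATION FORM: neither `f` nor
  the collision sum need be measurable — the route file
  `Theorems/LambertianContactSwapCollisionMomentBoundFlux` of the hydrodynamic-limit problem has a
  problem-side copy of the case `f = 𝟙_good · (collision sum)`);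
* `exists_windowEvent_of_pairBound` — the static one-window bound on `𝕋³` under the homogeneous
  Gibbs law `G_N` (rung 0) for a canonical pair law at most `C_p ×` Haar measure, ANY constant
  `C_p` (the parent file hard-wires the Ruelle constant `4` of the small-density regime; the crude
  free-volume bound gives `C_p = (1 − v₁σ³)⁻²` for every reduced density with `v₁σ³ < 1`):
  `∫ 𝟙_E A(vᵢ, vⱼ) dG_N ≤ C_p · 4ε²h · ∫ ‖w − v‖ A`;
* `localGibbsLaw_lintegral_le_of_le_collisionMarkSum` — hence, for a flow preserving `G_N`, the
  MEAN COLLISION-FLUX BOUND: every `f ≥ 0` dominated on the good set by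
  `Σ_{s ≤ τ} Σ_{(i,j) in contact} b(vᵢ(s), vⱼ(s))` has
  `E_{G_N} f ≤ C_p · 4τ(N+1)²ε² · ∫ ‖w − v‖ b(v, w) dN(u,θ)(v) dN(u,θ)(w)` (the mesh cancels,
  `M · τ/M = τ`).

The companion `HardSphereMeanCollisionCount` specialises to the mark `b ≡ 1` (mean number of
collisions of a window, mean number of busy particles) and makes the Gaussian flux integral and the
pair constant explicit for every reduced density `σ ≤ 1/2`.

## References

* C. Cercignani, R. Illner, M. Pulvirenti, *The Mathematical Theory of Dilute Gases* (1994),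
  App. 4.A.  [CIPDiluteGases1994]
* I. Gallagher, L. Saint-Raymond, B. Texier, *From Newton to Boltzmann* (2013), Prop. 4.1.1.  [GST2013]
* H. Spohn, *Large Scale Dynamics of Interacting Particles* (1991), Part I §2.3.  [Spohn1991]
-/

noncomputable section

open MeasureTheory Set Filter Topology
open scoped ENNReal InnerProductSpace BigOperators

namespace Literature.MathematicalPhysics.KineticTheory

open Literature.Analysis.FluidPDE Literature.Analysis.FunctionSpaces

/-! ## The mean of a collision sum under an invariant law -/

/-- **Functionals dominated by a collision sum have mean bounded by the one-window flux
(abstract form).** For a hard-sphere flow `Φ`, a law `P` preserved by every `Φ_t` and carried by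
the good set, `τ > 0`, a mark `F ≥ 0`, measurable window events
`E M i j ⊇ {(i,j) reaches contact under a backward free flight of duration ≤ τ/M}` and measurable
majorants `Ft M ≥ F` along those flights, every `f ≥ 0` dominated on the good set by the collision sum
`Σ_{collision times s ∈ [0,τ]} Σ_{ordered contact pairs (i,j)} F(Φ_s z, i, j)` has
`∫ f dP ≤ liminf_M M · ∫ Σ_{i≠j} 𝟙_{E M i j} F̃ M (·, i, j) dP` (pathwise grid bound
`sum_collision_le_sum_window` below the gap of the collision times, Fatou, stationarity — the first
three steps of `measure_collisionSum_ge_le_liminf`; Cercignani–Illner–Pulvirenti 1994 App. 4.A).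
No measurability of `f` or of the collision sum is needed. [folklore] -/
theorem lintegral_le_liminf_of_le_collisionSum {d X : Type*} [Fintype d] [MeasureSpace X]
    [TopologicalSpace X] {G : Geometry d X} {ε : ℝ} {n : ℕ} (Φ : HardSphereFlow G ε n)
    (P : Measure (Config n d X)) (hstat : ∀ t : ℝ, MeasurePreserving (Φ.flow t) P P)
    (hP : P Φ.goodᶜ = 0) {τ : ℝ} (hτ : 0 < τ) (F : Config n d X → Fin n → Fin n → ℝ≥0∞)
    (E : ℕ → Fin n → Fin n → Set (Config n d X)) (hEm : ∀ M i j, MeasurableSet (E M i j))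
    (hE : ∀ (M : ℕ) (i j : Fin n), i ≠ j → ∀ w ∈ hardSphereDomain G n ε, ∀ t ∈ Icc 0 (τ / M),
      ‖G.sepVec ((freeFlight G (-t) w i).1) ((freeFlight G (-t) w j).1)‖ = ε → w ∈ E M i j)
    (Ft : ℕ → Config n d X → Fin n → Fin n → ℝ≥0∞) (hFtm : ∀ M i j, Measurable fun w => Ft M w i j)
    (hFt : ∀ (M : ℕ) (i j : Fin n), i ≠ j → ∀ w ∈ hardSphereDomain G n ε, ∀ t ∈ Icc 0 (τ / M),
      ‖G.sepVec ((freeFlight G (-t) w i).1) ((freeFlight G (-t) w j).1)‖ = ε →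
        F (freeFlight G (-t) w) i j ≤ Ft M w i j)
    (f : Config n d X → ℝ≥0∞)
    (hf : ∀ z ∈ Φ.good, f z ≤ ∑ᶠ s ∈ collisionTimes G ε (fun t => Φ.flow t z) ∩ Icc 0 τ,
        ∑ i, ∑ j, (if i ≠ j ∧ ‖G.sepVec (Φ.flow s z i).1 (Φ.flow s z j).1‖ = ε
          then F (Φ.flow s z) i j else 0)) :
    ∫⁻ z, f z ∂P ≤
      liminf (fun M : ℕ => (M : ℝ≥0∞) *
        ∫⁻ w, ∑ i, ∑ j, (if i ≠ j then (E M i j).indicator (fun w => Ft M w i j) w else 0) ∂P) atTop := by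
  classical
  -- adapted from `measure_collisionSum_ge_le_liminf` (`CollisionFluxUpperBound`): steps (i)–(iii)
  set W : ℕ → Config n d X → ℝ≥0∞ := fun M w => ∑ i, ∑ j,
    (if i ≠ j then (E M i j).indicator (fun w => Ft M w i j) w else 0) with hWdef
  have hWm : ∀ M, Measurable (W M) := by
    intro M
    refine Finset.measurable_sum _ fun i _ => Finset.measurable_sum _ fun j _ => ?_
    by_cases hij : i ≠ j
    · simp only [if_pos hij]
      exact (hFtm M i j).indicator (hEm M i j)
    · simp only [if_neg hij]
      exact measurable_const
  set SM : ℕ → Config n d X → ℝ≥0∞ := fun M z =>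
    ∑ k ∈ Finset.Icc 1 M, W M (Φ.flow ((k : ℝ) * (τ / M)) z) with hSMdef
  have hSMm : ∀ M, Measurable (SM M) := fun M =>
    Finset.measurable_sum _ fun k _ => (hWm M).comp (Φ.measurable_flow _)
  set Kstar : Config n d X → ℝ≥0∞ := fun z => liminf (fun M => SM M z) atTop with hKdef
  -- (i) the pathwise bound on the good set, hence `f ≤ Kstar` almost everywhere
  have hpath : ∀ z ∈ Φ.good, f z ≤ Kstar z := by
    intro z hz
    refine (hf z hz).trans ?_
    have hγ := Φ.isTrajectory z hz
    have hfin := hγ.locFinite 0 τ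
    rw [finsum_mem_eq_finite_toFinset_sum _ hfin]
    obtain ⟨g, hg, hgap⟩ := exists_gap_of_finite hfin
    show _ ≤ liminf (fun M => SM M z) atTop
    refine le_liminf_of_le (h := ?_)
    filter_upwards [eventually_gt_atTop ⌈τ / g⌉₊] with M hM
    have hM0 : 0 < M := lt_of_le_of_lt (Nat.zero_le _) hM
    have hMg : τ / M < g := by
      have h1 : τ / g < M := (Nat.le_ceil _).trans_lt (by exact_mod_cast hM)
      rw [div_lt_iff₀ hg] at h1
      rw [div_lt_iff₀ (by exact_mod_cast hM0)]
      linarith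
    have hgap' : ∀ s ∈ collisionTimes G ε (fun t => Φ.flow t z) ∩ Icc 0 τ,
        ∀ s' ∈ collisionTimes G ε (fun t => Φ.flow t z) ∩ Icc 0 τ, s < s' → τ / M < s' - s :=
      fun s hs s' hs' hlt => hMg.trans_le (hgap s hs s' hs' hlt)
    exact sum_collision_le_sum_window hγ hτ hM0 hgap' (E M) (hE M) F (Ft M) (hFt M)
  have hae : ∀ᵐ z ∂P, f z ≤ Kstar z := by
    have h : ∀ᵐ z ∂P, z ∈ Φ.good := by
      rw [ae_iff]
      exact hP
    filter_upwards [h] with z hz using hpath z hz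
  -- (ii) the mean of each grid sum: stationarity
  have hmeanM : ∀ M, ∫⁻ z, SM M z ∂P = (M : ℝ≥0∞) * ∫⁻ w, W M w ∂P := by
    intro M
    calc ∫⁻ z, SM M z ∂P = ∑ k ∈ Finset.Icc 1 M, ∫⁻ z, W M (Φ.flow ((k : ℝ) * (τ / M)) z) ∂P :=
          lintegral_finsetSum _ fun k _ => (hWm M).comp (Φ.measurable_flow _)
      _ = ∑ _k ∈ Finset.Icc 1 M, ∫⁻ z, W M z ∂P :=
          Finset.sum_congr rfl fun k _ => (hstat _).lintegral_comp (hWm M)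
      _ = (M : ℝ≥0∞) * ∫⁻ w, W M w ∂P := by
          rw [Finset.sum_const, Nat.card_Icc, Nat.add_sub_cancel, nsmul_eq_mul]
  -- (iii) Fatou
  calc ∫⁻ z, f z ∂P ≤ ∫⁻ z, Kstar z ∂P := lintegral_mono_ae hae
    _ ≤ liminf (fun M : ℕ => ∫⁻ z, SM M z ∂P) atTop := lintegral_liminf_le hSMm
    _ = liminf (fun M : ℕ => (M : ℝ≥0∞) * ∫⁻ w, W M w ∂P) atTop :=
        congrArg (fun u : ℕ → ℝ≥0∞ => liminf u atTop) (funext hmeanM)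

/-! ## The one-window event on `𝕋³` under `G_N`, general pair constant -/

/-- **The one-window collision event and its static Gibbs bound, for a pair law at most
`C_p ×` Haar measure.** As `exists_windowEvent`, with the constant `4` of the small-density Ruelle
bound replaced by an arbitrary `C_p : ℝ≥0∞` (`hpair`): for `σ ≤ 1/2`, constant profiles
`a, θ > 0`, `u`, `N + 1` spheres of diameter `ε = hsDiameter σ N`, a window length `h ≥ 0`, labels
`i ≠ j`, a measurable swept-tube family `S` of volume `≤ 4 ε² h ‖u‖` (`hSm`, `hSvol`, `hS`) and
the Haar-versus-Lebesgue inequality for minimal-image lifts (`hlift`), there is a measurable event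
`E` containing every non-overlapping configuration whose pair `(i, j)` comes to contact after a
backward free flight of some duration `t ∈ [0, h]`, with
`∫ 𝟙_E(w) A(vᵢ, vⱼ) dG_N(w) ≤ C_p · 4 ε² h · ∫ ‖p.2 − p.1‖ A(p) d(N(u,θ) ⊗ N(u,θ))(p)` for every
measurable weight `A` of the two velocities. [folklore] -/
theorem exists_windowEvent_of_pairBound {σ : ℝ} (hσ2 : σ ≤ 1 / 2) {a θ : ℝ} (ha : 0 < a)
    (hθ : 0 < θ) (u : V3) {N : ℕ} {h : ℝ} (hh : 0 ≤ h) {i j : Fin (N + 1)} (hij : i ≠ j) {Cp : ℝ≥0∞}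
    (hpair : ∀ T : Set T3, MeasurableSet T →
      posGibbsMeasure (fun _ : T3 => (1 : ℝ)) (hsDiameter σ N) (N + 1) {x | x i - x j ∈ T} ≤ Cp * volume T)
    {S : V3 → Set V3} (hSm : MeasurableSet {q : V3 × V3 | q.1 ∈ S q.2})
    (hSvol : ∀ u, volume (S u) ≤ ENNReal.ofReal (4 * hsDiameter σ N ^ 2 * h * ‖u‖))
    (hS : ∀ (u r : V3) (s : ℝ), hsDiameter σ N ≤ ‖r‖ → s ∈ Icc 0 h → ‖r + s • u‖ = hsDiameter σ N → r ∈ S u)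
    (hlift : ∀ B : Set V3, MeasurableSet B →
      volume {x : T3 | ∃ k : Fin 3 → ℤ, Torus.reprSym x + Torus.latticeVec k ∈ B} ≤ volume B) :
    ∃ E : Set (Config (N + 1) (Fin 3) T3), MeasurableSet E ∧
      (∀ w ∈ hardSphereDomain (Torus.geometry (Fin 3)) (N + 1) (hsDiameter σ N), ∀ t ∈ Icc 0 h,
        ‖(Torus.geometry (Fin 3)).sepVec ((freeFlight (Torus.geometry (Fin 3)) (-t) w i).1)
            ((freeFlight (Torus.geometry (Fin 3)) (-t) w j).1)‖ = hsDiameter σ N → w ∈ E) ∧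
      ∀ (Φ : HardSphereFlow (Torus.geometry (Fin 3)) (hsDiameter σ N) (N + 1)) (A : V3 × V3 → ℝ≥0∞),
        Measurable A →
        ∫⁻ w, E.indicator (fun w => A ((w i).2, (w j).2)) w
            ∂(localGibbsLaw σ (fun _ => a) (fun _ => u) (fun _ => θ) N Φ) ≤
          Cp * ENNReal.ofReal (4 * hsDiameter σ N ^ 2 * h) *
            ∫⁻ p, ENNReal.ofReal ‖p.2 - p.1‖ * A p ∂((gaussMeasure u θ).prod (gaussMeasure u θ)) := by
  -- adapted from `exists_windowEvent` (constant `4` ↦ `Cp`)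
  set ε := hsDiameter σ N with hεdef
  set ψ : (Fin 3 → ℤ) → Config (N + 1) (Fin 3) T3 → V3 × V3 := fun k w =>
    (Torus.reprSym ((w i).1 - (w j).1) + Torus.latticeVec k, (w j).2 - (w i).2) with hψ
  have hψm : ∀ k, Measurable (ψ k) := by
    intro k
    refine Measurable.prodMk ?_ ?_
    · exact (Torus.measurable_reprSym.comp
        ((measurable_pi_apply i).fst.sub (measurable_pi_apply j).fst)).add_const _
    · exact (measurable_pi_apply j).snd.sub (measurable_pi_apply i).snd
  set E : Set (Config (N + 1) (Fin 3) T3) := ⋃ k, ψ k ⁻¹' {q : V3 × V3 | q.1 ∈ S q.2} with hE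
  have hEm : MeasurableSet E := MeasurableSet.iUnion fun k => hSm.preimage (hψm k)
  refine ⟨E, hEm, ?_, ?_⟩
  · intro w hw t ht hc
    obtain ⟨k, hk⟩ := exists_latticeVec_add_mem_of_contact hS hw hij ht hc
    exact mem_iUnion.2 ⟨k, hk⟩
  intro Φ A hA
  have hSu : ∀ v : V3, MeasurableSet (S v) := fun v =>
    hSm.preimage (measurable_id.prodMk measurable_const)
  set T : (Fin (N + 1) → V3) → Set T3 := fun v =>
    {p | ∃ k : Fin 3 → ℤ, Torus.reprSym p + Torus.latticeVec k ∈ S (v j - v i)} with hT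
  have hTm : ∀ v, MeasurableSet (T v) := by
    intro v
    have : T v = ⋃ k : Fin 3 → ℤ, (fun p : T3 => Torus.reprSym p + Torus.latticeVec k) ⁻¹'
        S (v j - v i) := by
      ext p; simp only [hT, mem_setOf_eq, mem_iUnion, mem_preimage]
    rw [this]
    exact MeasurableSet.iUnion fun k => (hSu _).preimage (Torus.measurable_reprSym.add_const _)
  have hTvol : ∀ v, volume (T v) ≤ ENNReal.ofReal (4 * ε ^ 2 * h * ‖v j - v i‖) := fun v =>
    (hlift _ (hSu _)).trans (hSvol _)
  set F : Config (N + 1) (Fin 3) T3 → ℝ≥0∞ := E.indicator fun w => A ((w i).2, (w j).2) with hF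
  have hAm : Measurable fun w : Config (N + 1) (Fin 3) T3 => A ((w i).2, (w j).2) :=
    hA.comp ((measurable_pi_apply i).snd.prodMk (measurable_pi_apply j).snd)
  have hFm : Measurable F := hAm.indicator hEm
  set Q := posGibbsMeasure (fun _ : T3 => a) ε (N + 1) with hQ
  set Γ : Measure (Fin (N + 1) → V3) := Measure.pi fun _ => gaussMeasure u θ with hΓ
  have hlaw : localGibbsLaw σ (fun _ => a) (fun _ => u) (fun _ => θ) N Φ = (Q.prod Γ).map zipConfig := by
    rw [localGibbsLaw_eq, localGibbsMeasure_rung0_eq_map σ ha.le hθ u N]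
  haveI : IsProbabilityMeasure Q :=
    isProbabilityMeasure_posGibbsMeasure continuous_const (fun _ => ha) hσ2 N
  haveI : IsProbabilityMeasure Γ := by rw [hΓ]; infer_instance
  have hsec : ∀ v : Fin (N + 1) → V3,
      ∫⁻ x, F (zipConfig (x, v)) ∂Q ≤ A (v i, v j) * (Cp * ENNReal.ofReal (4 * ε ^ 2 * h * ‖v j - v i‖)) := by
    intro v
    have hle : ∀ x, F (zipConfig (x, v)) ≤ {x : Fin (N + 1) → T3 | x i - x j ∈ T v}.indicator
        (fun _ => A (v i, v j)) x := by
      intro x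
      by_cases hx : zipConfig (x, v) ∈ E
      · have hx' : x ∈ {x : Fin (N + 1) → T3 | x i - x j ∈ T v} := by
          obtain ⟨k, hk⟩ := mem_iUnion.1 hx
          exact ⟨k, by simpa only [hψ, zipConfig_apply, mem_preimage, mem_setOf_eq] using hk⟩
        rw [hF, indicator_of_mem hx, indicator_of_mem hx']
        simp only [zipConfig_apply, le_refl]
      · rw [hF, indicator_of_notMem hx]
        exact bot_le
    calc ∫⁻ x, F (zipConfig (x, v)) ∂Q
        ≤ ∫⁻ x, {x : Fin (N + 1) → T3 | x i - x j ∈ T v}.indicator (fun _ => A (v i, v j)) x ∂Q :=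
          lintegral_mono hle
      _ ≤ A (v i, v j) * Q {x | x i - x j ∈ T v} := lintegral_indicator_const_le _ _
      _ ≤ A (v i, v j) * (Cp * volume (T v)) := by
          have hQ' : Q {x | x i - x j ∈ T v} ≤ Cp * volume (T v) := by
            rw [hQ, posGibbsMeasure_const_eq_one ha]
            exact hpair _ (hTm v)
          gcongr
      _ ≤ A (v i, v j) * (Cp * ENNReal.ofReal (4 * ε ^ 2 * h * ‖v j - v i‖)) := by
          gcongr
          exact hTvol v
  calc ∫⁻ w, F w ∂(localGibbsLaw σ (fun _ => a) (fun _ => u) (fun _ => θ) N Φ)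
      = ∫⁻ pr, F (zipConfig pr) ∂(Q.prod Γ) := by rw [hlaw, lintegral_map hFm measurable_zipConfig]
    _ = ∫⁻ v, ∫⁻ x, F (zipConfig (x, v)) ∂Q ∂Γ :=
        lintegral_prod_symm _ (hFm.comp measurable_zipConfig).aemeasurable
    _ ≤ ∫⁻ v, A (v i, v j) * (Cp * ENNReal.ofReal (4 * ε ^ 2 * h * ‖v j - v i‖)) ∂Γ := lintegral_mono hsec
    _ = ∫⁻ p, A p * (Cp * ENNReal.ofReal (4 * ε ^ 2 * h * ‖p.2 - p.1‖))
          ∂((gaussMeasure u θ).prod (gaussMeasure u θ)) := by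
        rw [hΓ]
        exact lintegral_pi_pair (gaussMeasure u θ) hij
          (f := fun p : V3 × V3 => A p * (Cp * ENNReal.ofReal (4 * ε ^ 2 * h * ‖p.2 - p.1‖)))
          (hA.mul ((by fun_prop : Measurable fun p : V3 × V3 =>
            ENNReal.ofReal (4 * ε ^ 2 * h * ‖p.2 - p.1‖)).const_mul Cp))
    _ = ∫⁻ p, Cp * ENNReal.ofReal (4 * ε ^ 2 * h) * (ENNReal.ofReal ‖p.2 - p.1‖ * A p)
          ∂((gaussMeasure u θ).prod (gaussMeasure u θ)) := by
        refine lintegral_congr fun p => ?_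
        rw [show 4 * ε ^ 2 * h * ‖p.2 - p.1‖ = (4 * ε ^ 2 * h) * ‖p.2 - p.1‖ by ring,
          ENNReal.ofReal_mul (by positivity)]
        ring
    _ = Cp * ENNReal.ofReal (4 * ε ^ 2 * h) *
          ∫⁻ p, ENNReal.ofReal ‖p.2 - p.1‖ * A p ∂((gaussMeasure u θ).prod (gaussMeasure u θ)) :=
        lintegral_const_mul'' _ ((by fun_prop : Measurable fun p : V3 × V3 =>
          ENNReal.ofReal ‖p.2 - p.1‖).mul hA).aemeasurable

/-! ## The mean collision-flux bound under `G_N` -/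

/-- **The collision-flux upper bound for the mean, rung 0 (domination form).** For `σ ≤ 1/2`,
constant profiles `a, θ > 0`, `u`, a hard-sphere flow `Φ` of `N + 1` spheres of diameter
`ε = hsDiameter σ N` on `𝕋³` preserving the homogeneous Gibbs law `G_N` (`hstat`), a canonical pair
law at most `C_p ×` Haar measure (`hpair`), swept-tube families (`htube`) and the minimal-image lift
inequality (`hlift`): for `τ > 0` and a measurable `ℝ≥0∞`-valued mark `b` of two velocities, every
`f ≥ 0` dominated on the good set by the collision sum
`Σ_{collision times s ∈ [0,τ]} Σ_{ordered contact pairs (i,j)} b(vᵢ(s), vⱼ(s))` has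
`∫ f dG_N ≤ C_p · 4 τ (N+1)² ε² · ∫ ‖p.2 − p.1‖ b(p) d(N(u,θ) ⊗ N(u,θ))(p)`
(Cercignani–Illner–Pulvirenti 1994 App. 4.A: the Boltzmann–Enskog flux through the contact
cylinders bounds the mean collision sum; uniform in `N` at fixed reduced density,
`(N+1)² ε² = σ² (N+1)/ε`; `G_N` is carried by the good set). [folklore] -/
theorem localGibbsLaw_lintegral_le_of_le_collisionMarkSum {σ : ℝ} (hσ2 : σ ≤ 1 / 2) {a θ : ℝ}
    (ha : 0 < a) (hθ : 0 < θ) (u : V3) {N : ℕ}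
    (Φ : HardSphereFlow (Torus.geometry (Fin 3)) (hsDiameter σ N) (N + 1))
    (hstat : ∀ t : ℝ, MeasurePreserving (Φ.flow t) (localGibbsLaw σ (fun _ => a) (fun _ => u) (fun _ => θ) N Φ)
      (localGibbsLaw σ (fun _ => a) (fun _ => u) (fun _ => θ) N Φ)) {Cp : ℝ≥0∞}
    (hpair : ∀ i j : Fin (N + 1), i ≠ j → ∀ T : Set T3, MeasurableSet T →
      posGibbsMeasure (fun _ : T3 => (1 : ℝ)) (hsDiameter σ N) (N + 1) {x | x i - x j ∈ T} ≤ Cp * volume T)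
    (htube : ∀ h : ℝ, 0 ≤ h → ∃ S : V3 → Set V3, MeasurableSet {q : V3 × V3 | q.1 ∈ S q.2} ∧
      (∀ u, volume (S u) ≤ ENNReal.ofReal (4 * hsDiameter σ N ^ 2 * h * ‖u‖)) ∧
      ∀ (u r : V3) (s : ℝ), hsDiameter σ N ≤ ‖r‖ → s ∈ Icc 0 h → ‖r + s • u‖ = hsDiameter σ N → r ∈ S u)
    (hlift : ∀ B : Set V3, MeasurableSet B →
      volume {x : T3 | ∃ k : Fin 3 → ℤ, Torus.reprSym x + Torus.latticeVec k ∈ B} ≤ volume B)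
    {τ : ℝ} (hτ : 0 < τ) {b : V3 × V3 → ℝ≥0∞} (hbm : Measurable b)
    (f : Config (N + 1) (Fin 3) T3 → ℝ≥0∞)
    (hf : ∀ z ∈ Φ.good, f z ≤ ∑ᶠ s ∈ collisionTimes (Torus.geometry (Fin 3)) (hsDiameter σ N)
          (fun t => Φ.flow t z) ∩ Icc 0 τ,
        ∑ i : Fin (N + 1), ∑ j : Fin (N + 1),
          (if i ≠ j ∧ ‖(Torus.geometry (Fin 3)).sepVec (Φ.flow s z i).1 (Φ.flow s z j).1‖ =
              hsDiameter σ N then b ((Φ.flow s z i).2, (Φ.flow s z j).2) else 0)) :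
    ∫⁻ z, f z ∂(localGibbsLaw σ (fun _ => a) (fun _ => u) (fun _ => θ) N Φ) ≤
      Cp * ENNReal.ofReal (4 * τ * ((N + 1 : ℕ) : ℝ) ^ 2 * hsDiameter σ N ^ 2) *
        ∫⁻ p, ENNReal.ofReal ‖p.2 - p.1‖ * b p ∂((gaussMeasure u θ).prod (gaussMeasure u θ)) := by
  classical
  -- adapted from `localGibbsLaw_collisionMarkSum_ge_le` (Markov form) of `CollisionFluxUpperBound`
  set P := localGibbsLaw σ (fun _ => a) (fun _ => u) (fun _ => θ) N Φ with hPdef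
  have hP : P Φ.goodᶜ = 0 := by
    rw [hPdef, localGibbsLaw_eq]
    exact localGibbsMeasure_absolutelyContinuous σ _ _ _ N Φ Φ.measure_compl_good
  set I : ℝ≥0∞ := ∫⁻ p, ENNReal.ofReal ‖p.2 - p.1‖ * b p ∂((gaussMeasure u θ).prod (gaussMeasure u θ))
    with hIdef
  -- the mark as a function of the configuration, unchanged along free flight
  set F : Config (N + 1) (Fin 3) T3 → Fin (N + 1) → Fin (N + 1) → ℝ≥0∞ :=
    fun w i j => b ((w i).2, (w j).2) with hFdef
  have hFm : ∀ i j, Measurable fun w => F w i j :=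
    fun i j => hbm.comp ((measurable_pi_apply i).snd.prodMk (measurable_pi_apply j).snd)
  have hFfree : ∀ (t : ℝ) (w : Config (N + 1) (Fin 3) T3) (i j : Fin (N + 1)),
      F (freeFlight (Torus.geometry (Fin 3)) (-t) w) i j = F w i j := by
    intro t w i j
    simp only [hFdef, freeFlight_apply]
  -- the window events, for every mesh `τ / M` and every ordered pair
  have hev : ∀ (M : ℕ) (i j : Fin (N + 1)), ∃ E : Set (Config (N + 1) (Fin 3) T3), MeasurableSet E ∧
      (i ≠ j → ∀ w ∈ hardSphereDomain (Torus.geometry (Fin 3)) (N + 1) (hsDiameter σ N),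
        ∀ t ∈ Icc 0 (τ / M),
        ‖(Torus.geometry (Fin 3)).sepVec ((freeFlight (Torus.geometry (Fin 3)) (-t) w i).1)
          ((freeFlight (Torus.geometry (Fin 3)) (-t) w j).1)‖ = hsDiameter σ N → w ∈ E) ∧
      (i ≠ j → ∫⁻ w, E.indicator (fun w => F w i j) w ∂P ≤
        Cp * ENNReal.ofReal (4 * hsDiameter σ N ^ 2 * (τ / M)) * I) := by
    intro M i j
    by_cases hij : i ≠ j
    · have hh : 0 ≤ τ / M := div_nonneg hτ.le (Nat.cast_nonneg M)
      obtain ⟨S, hSm, hSvol, hS⟩ := htube (τ / M) hh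
      obtain ⟨E, hEm, hEc, hEb⟩ := exists_windowEvent_of_pairBound hσ2 ha hθ u hh hij (hpair i j hij)
        hSm hSvol hS hlift
      exact ⟨E, hEm, fun _ => hEc, fun _ => hEb Φ b hbm⟩
    · exact ⟨∅, MeasurableSet.empty, fun h => absurd h hij, fun h => absurd h hij⟩
  choose E hEm hEc hEb using hev
  have hgen := lintegral_le_liminf_of_le_collisionSum Φ P hstat hP hτ F (fun M i j => E M i j) hEm
    (fun M i j hij => hEc M i j hij) (fun _ => F) (fun _ i j => hFm i j)
    (fun M i j _ w _ t _ _ => (hFfree t w i j).le) f hf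
  -- the mean of one window: the static bound, `(N+1)²` ordered pairs, and `M · (τ/M) = τ`
  have hB : ∀ M : ℕ, (M : ℝ≥0∞) * ∫⁻ w, ∑ i, ∑ j,
      (if i ≠ j then (E M i j).indicator (fun w => F w i j) w else 0) ∂P ≤
        Cp * ENNReal.ofReal (4 * τ * ((N + 1 : ℕ) : ℝ) ^ 2 * hsDiameter σ N ^ 2) * I := by
    intro M
    rcases Nat.eq_zero_or_pos M with hM0 | hM0
    · subst hM0
      simp only [Nat.cast_zero, zero_mul, zero_le]
    have hM' : (0 : ℝ) < M := by exact_mod_cast hM0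
    have hterm : ∀ i j : Fin (N + 1), ∫⁻ w, (if i ≠ j then (E M i j).indicator
        (fun w => F w i j) w else 0) ∂P ≤ Cp * ENNReal.ofReal (4 * hsDiameter σ N ^ 2 * (τ / M)) * I := by
      intro i j
      by_cases hij : i ≠ j
      · simp only [if_pos hij]; exact hEb M i j hij
      · simp only [if_neg hij, lintegral_zero, zero_le]
    have hmeas : ∀ i j : Fin (N + 1), Measurable fun w : Config (N + 1) (Fin 3) T3 =>
        (if i ≠ j then (E M i j).indicator (fun w => F w i j) w else 0) := by
      intro i j
      by_cases hij : i ≠ j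
      · simp only [if_pos hij]; exact (hFm i j).indicator (hEm M i j)
      · simp only [if_neg hij]; exact measurable_const
    calc (M : ℝ≥0∞) * ∫⁻ w, ∑ i, ∑ j, (if i ≠ j then (E M i j).indicator (fun w => F w i j) w else 0) ∂P
        = (M : ℝ≥0∞) * ∑ i, ∑ j, ∫⁻ w, (if i ≠ j then (E M i j).indicator (fun w => F w i j) w else 0) ∂P := by
          congr 1
          rw [lintegral_finsetSum _ fun i _ => Finset.measurable_sum _ fun j _ => hmeas i j]
          exact Finset.sum_congr rfl fun i _ => lintegral_finsetSum _ fun j _ => hmeas i j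
      _ ≤ (M : ℝ≥0∞) * ∑ _i : Fin (N + 1), ∑ _j : Fin (N + 1),
            Cp * ENNReal.ofReal (4 * hsDiameter σ N ^ 2 * (τ / M)) * I := by
          gcongr with i _ j _
          exact hterm i j
      _ = Cp * ENNReal.ofReal (4 * τ * ((N + 1 : ℕ) : ℝ) ^ 2 * hsDiameter σ N ^ 2) * I := by
          simp only [Finset.sum_const, Finset.card_univ, Fintype.card_fin, nsmul_eq_mul]
          have h1 : (M : ℝ≥0∞) = ENNReal.ofReal (M : ℝ) := (ENNReal.ofReal_natCast M).symm
          have h2 : ((N + 1 : ℕ) : ℝ≥0∞) = ENNReal.ofReal ((N + 1 : ℕ) : ℝ) := (ENNReal.ofReal_natCast _).symm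
          rw [h1, h2]
          have h3 : ENNReal.ofReal (M : ℝ) * (ENNReal.ofReal ((N + 1 : ℕ) : ℝ) *
              (ENNReal.ofReal ((N + 1 : ℕ) : ℝ) *
                (Cp * ENNReal.ofReal (4 * hsDiameter σ N ^ 2 * (τ / M)) * I))) =
              Cp * (ENNReal.ofReal (M : ℝ) * ENNReal.ofReal ((N + 1 : ℕ) : ℝ) *
                ENNReal.ofReal ((N + 1 : ℕ) : ℝ) * ENNReal.ofReal (4 * hsDiameter σ N ^ 2 * (τ / M))) * I := by
            ring
          rw [h3, ← ENNReal.ofReal_mul (Nat.cast_nonneg _), ← ENNReal.ofReal_mul (by positivity),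
            ← ENNReal.ofReal_mul (by positivity)]
          congr 3
          field_simp
  exact hgen.trans (liminf_le_of_frequently_le' (Frequently.of_forall hB))

end Literature.MathematicalPhysics.KineticTheory

end
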